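import Literature.NumberTheory.LFunctions.WeilZeroSum
import Literature.NumberTheory.LFunctions.RHWave0
import Mathlib.Analysis.PSeries
import Mathlib.Algebra.Order.Round
import HarnessLib

/-!
# Half-isolated zeros (Maynard–Pratt 2024), IV: sums over the zeros of `ζ` near a given height

Topic `Literature/NumberTheory/LFunctions`. Everything in this file is PROVED (no definition, no
named fact). Zero-counting input of the in-tree proof of Proposition 16 of

* J. Maynard, K. Pratt, *Half-isolated zeros and zero-density estimates*, IMRN 2024 =
  arXiv:2206.11729 (proofs of Lemma 15 and Proposition 16, p. 10: "`Σ_ρ |W(ρ−ρ₀)| ≪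
  Σ_{ρ : ζ(ρ)=0} min(1, |ρ−ρ₀|⁻²) ≪ log T`", and the discarding of the zeros far from `ρ₀`),

namely the consequences of `N(T+1) − N(T) ≪ log T` that these proofs use, for sums over FINITE sets
of non-trivial zeros (`RHWave0.riemannZetaNontrivialZeros`), each zero weighted by its multiplicity
`m(ρ) = riemannZetaZeroOrder ρ` (the explicit formula counts zeros with multiplicity), with
constants uniform in the height:

* `exists_sum_order_window_le` — zeros of ALL real parts in a unit window:
  `Σ_{|γ−τ| ≤ 1/2} m(ρ) ≤ C log(|τ|+2)` (the tree's Jensen count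
  `Literature.NumberTheory.LFunctions.exists_sum_zetaZeroWindow_le` covers `β ≥ 1/4`; the zeros
  with `β < 1/4` are reflected by `ρ ↦ 1 − ρ̄`, which preserves ordinates and multiplicities).
* `sum_order_mul_le_tsum_windows` — the window decomposition
  `Σ_ρ m(ρ)φ(ρ) ≤ C₀ Σ_{k∈ℤ} G(k) log(|t+k|+2)` whenever `φ(ρ) ≤ G(round(γ − t))`.
* `exists_sum_order_div_one_add_sq_le` — **`Σ_ρ m(ρ)/(1+(γ−t)²) ≤ C log(|t|+2)`**.
* `exists_sum_order_mul_exp_neg_sqrt_le` — the far zeros against the sub-exponential Mellin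
  decay of `w₀` (`HalfIsolatedZeroMellin.lean`): for `M ≥ 25` and zeros with `|γ − t| ≥ M`,
  `Σ m(ρ) e^{−(4/5)√|γ−t|} ≤ C M² e^{−(4/5)√M} log(|t|+2)`.
* Series over `ℤ`: `summable_one_div_one_add_sq`, `summable_log_div_one_add_sq`,
  `exists_tsum_kernel_windows_le` (`Σ_k log(|t+k|+2)/(1+k²) ≪ log(|t|+2)`).

## References

* J. Maynard, K. Pratt, IMRN 2024 = arXiv:2206.11729, proofs of Lemma 15 and Proposition 16,
  p. 10. (`MaynardPratt2024`)
* H. L. Montgomery, R. C. Vaughan, *Multiplicative Number Theory I*, CUP 2007, Thm. 10.13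
  (`N(T+1) − N(T) ≪ log T`), via `ZetaZerosJensen.lean`. (`MontgomeryVaughan2007`)
-/

noncomputable section

open Complex Real Set Filter Asymptotics
open scoped ComplexConjugate

namespace Literature.NumberTheory.LFunctions

namespace MaynardPratt

/-! ## Unit windows, all real parts -/

open ZetaZeros.riemannZetaNontrivialZeros in
/-- **Zeros in a unit window, all real parts** (`N(τ + 1/2) − N(τ − 1/2) ≪ log(|τ| + 2)`,
Montgomery–Vaughan Thm. 10.13, counting multiplicity): there is an absolute `C` such that for every
real `τ` and every finite set of non-trivial zeros `ρ` with `|Im ρ − τ| ≤ 1/2`,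
`Σ m(ρ) ≤ C log(|τ| + 2)`. The right half `β ≥ 1/4` is the tree's Jensen count
(`exists_sum_zetaZeroWindow_le`); the zeros with `β < 1/4` are mapped injectively into the same
window by `ρ ↦ 1 − ρ̄` (`riemannZetaZeroOrder_one_sub_conj`).
[cite: MontgomeryVaughan2007, Thm. 10.13] -/
theorem exists_sum_order_window_le :
    ∃ C : ℝ, 0 < C ∧ ∀ (τ : ℝ) (F : Finset ℂ),
      (∀ ρ ∈ F, ρ ∈ RHWave0.riemannZetaNontrivialZeros ∧ |ρ.im - τ| ≤ 1 / 2) →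
      ∑ ρ ∈ F, (riemannZetaZeroOrder ρ : ℝ) ≤ C * Real.log (|τ| + 2) := by
  classical
  obtain ⟨C, hC, hwin⟩ := exists_sum_zetaZeroWindow_le
  refine ⟨2 * C, by positivity, fun τ F hF ↦ ?_⟩
  have hnn : ∀ ρ ∈ (zetaZeroWindow_finite τ).toFinset, (0 : ℝ) ≤ riemannZetaZeroOrder ρ := by
    intro ρ hρ
    rw [Set.Finite.mem_toFinset] at hρ
    exact riemannZetaZeroOrder_nonneg_of_zero hρ.1
  rw [← Finset.sum_filter_add_sum_filter_not F (fun ρ : ℂ ↦ (1 / 4 : ℝ) ≤ ρ.re), two_mul, add_mul]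
  refine add_le_add ?_ ?_
  · refine le_trans (Finset.sum_le_sum_of_subset_of_nonneg ?_ fun ρ hρ _ ↦ hnn ρ hρ) (hwin τ)
    intro ρ hρ
    rw [Finset.mem_filter] at hρ
    rw [Set.Finite.mem_toFinset]
    exact ⟨zeta_eq_zero (hF ρ hρ.1).1, hρ.2, (hF ρ hρ.1).2⟩
  · set F₂ := F.filter (fun ρ : ℂ ↦ ¬ (1 / 4 : ℝ) ≤ ρ.re) with hF₂
    have hinj : Set.InjOn (fun ρ : ℂ ↦ 1 - conj ρ) F₂ := by
      intro a _ b _ h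
      have := congrArg conj (sub_right_injective h)
      simpa using this
    calc ∑ ρ ∈ F₂, (riemannZetaZeroOrder ρ : ℝ)
        = ∑ ρ ∈ F₂, (riemannZetaZeroOrder (1 - conj ρ) : ℝ) := by
          refine Finset.sum_congr rfl fun ρ hρ ↦ ?_
          rw [Finset.mem_filter] at hρ
          have h := (hF ρ hρ.1).1
          rw [riemannZetaZeroOrder_one_sub_conj (re_pos h) (re_lt_one h)]
      _ = ∑ ρ' ∈ F₂.image (fun ρ : ℂ ↦ 1 - conj ρ), (riemannZetaZeroOrder ρ' : ℝ) :=
          (Finset.sum_image (f := fun ρ' : ℂ ↦ (riemannZetaZeroOrder ρ' : ℝ)) hinj).symm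
      _ ≤ ∑ ρ ∈ (zetaZeroWindow_finite τ).toFinset, (riemannZetaZeroOrder ρ : ℝ) := by
          refine Finset.sum_le_sum_of_subset_of_nonneg ?_ fun ρ hρ _ ↦ hnn ρ hρ
          intro ρ' hρ'
          rw [Finset.mem_image] at hρ'
          obtain ⟨ρ, hρ, rfl⟩ := hρ'
          rw [Finset.mem_filter, not_le] at hρ
          have h := (hF ρ hρ.1).1
          have hmem := one_sub_conj_mem h
          rw [Set.Finite.mem_toFinset]
          refine ⟨zeta_eq_zero hmem, ?_, ?_⟩
          · simp only [sub_re, one_re, conj_re]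
            linarith [hρ.2]
          · simpa using (hF ρ hρ.1).2
      _ ≤ C * Real.log (|τ| + 2) := hwin τ

open ZetaZeros.riemannZetaNontrivialZeros in
/-- **Window decomposition of a weighted sum over zeros.** If every unit window at height `τ`
carries total multiplicity `≤ C₀ log(|τ|+2)`, and the weight satisfies `φ(ρ) ≤ G(k)` on the window
`k = round(Im ρ − t)`, then `Σ_{ρ∈F} m(ρ)φ(ρ) ≤ C₀ Σ_{k∈ℤ} G(k) log(|t+k|+2)` for every finite set
`F` of non-trivial zeros (group the zeros by window; `sum_le_tsum`). [folklore] -/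
theorem sum_order_mul_le_tsum_windows {C₀ : ℝ} (hC₀ : 0 ≤ C₀)
    (hwin : ∀ (τ : ℝ) (F : Finset ℂ),
      (∀ ρ ∈ F, ρ ∈ RHWave0.riemannZetaNontrivialZeros ∧ |ρ.im - τ| ≤ 1 / 2) →
      ∑ ρ ∈ F, (riemannZetaZeroOrder ρ : ℝ) ≤ C₀ * Real.log (|τ| + 2))
    (t : ℝ) (F : Finset ℂ) (hF : ∀ ρ ∈ F, ρ ∈ RHWave0.riemannZetaNontrivialZeros)
    (φ : ℂ → ℝ) (G : ℤ → ℝ) (hG0 : ∀ k, 0 ≤ G k)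
    (hGs : Summable fun k : ℤ ↦ G k * Real.log (|t + k| + 2))
    (hφ : ∀ ρ ∈ F, φ ρ ≤ G (round (ρ.im - t))) :
    ∑ ρ ∈ F, (riemannZetaZeroOrder ρ : ℝ) * φ ρ ≤
      C₀ * ∑' k : ℤ, G k * Real.log (|t + k| + 2) := by
  classical
  set w : ℂ → ℤ := fun ρ ↦ round (ρ.im - t) with hw
  have hm0 : ∀ ρ ∈ F, (0 : ℝ) ≤ riemannZetaZeroOrder ρ := fun ρ hρ ↦
    riemannZetaZeroOrder_nonneg_of_zero (zeta_eq_zero (hF ρ hρ))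
  have hlog0 : ∀ k : ℤ, 0 ≤ Real.log (|t + k| + 2) := fun k ↦
    Real.log_nonneg (by linarith [abs_nonneg (t + k)])
  calc ∑ ρ ∈ F, (riemannZetaZeroOrder ρ : ℝ) * φ ρ
      ≤ ∑ ρ ∈ F, (riemannZetaZeroOrder ρ : ℝ) * G (w ρ) :=
        Finset.sum_le_sum fun ρ hρ ↦ mul_le_mul_of_nonneg_left (hφ ρ hρ) (hm0 ρ hρ)
    _ = ∑ k ∈ F.image w, ∑ ρ ∈ F with w ρ = k, (riemannZetaZeroOrder ρ : ℝ) * G (w ρ) :=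
        (Finset.sum_fiberwise_of_maps_to (fun ρ hρ ↦ Finset.mem_image_of_mem w hρ) _).symm
    _ = ∑ k ∈ F.image w, G k * ∑ ρ ∈ F with w ρ = k, (riemannZetaZeroOrder ρ : ℝ) := by
        refine Finset.sum_congr rfl fun k _ ↦ ?_
        rw [Finset.mul_sum]
        refine Finset.sum_congr rfl fun ρ hρ ↦ ?_
        rw [Finset.mem_filter] at hρ
        rw [hρ.2, mul_comm]
    _ ≤ ∑ k ∈ F.image w, G k * (C₀ * Real.log (|t + k| + 2)) := by
        refine Finset.sum_le_sum fun k _ ↦ mul_le_mul_of_nonneg_left ?_ (hG0 k)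
        refine hwin (t + k) _ fun ρ hρ ↦ ?_
        rw [Finset.mem_filter] at hρ
        refine ⟨hF ρ hρ.1, ?_⟩
        have h := abs_sub_round (ρ.im - t)
        rw [← hρ.2]
        calc |ρ.im - (t + ((round (ρ.im - t) : ℤ) : ℝ))| = |ρ.im - t - round (ρ.im - t)| := by
              ring_nf
          _ ≤ 1 / 2 := h
    _ = C₀ * ∑ k ∈ F.image w, G k * Real.log (|t + k| + 2) := by
        rw [Finset.mul_sum]
        refine Finset.sum_congr rfl fun k _ ↦ by ring
    _ ≤ C₀ * ∑' k : ℤ, G k * Real.log (|t + k| + 2) := by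
        gcongr
        exact hGs.sum_le_tsum _ fun k _ ↦ mul_nonneg (hG0 k) (hlog0 k)

/-! ## Two summable series over `ℤ` -/

/-- `Σ_{k ∈ ℤ} |k|^{-3/2} < ∞`-comparison: a function on `ℤ` bounded by `c |k|^{-3/2}` off `0` is
summable. [folklore] -/
theorem summable_of_le_abs_rpow {f : ℤ → ℝ} (c : ℝ)
    (h : ∀ k : ℤ, k ≠ 0 → ‖f k‖ ≤ c * |(k : ℝ)| ^ (-(3 / 2 : ℝ))) : Summable f := by
  refine summable_of_isBigO (Real.summable_abs_int_rpow (b := 3 / 2) (by norm_num)) ?_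
  refine IsBigO.of_bound c ?_
  filter_upwards [eventually_cofinite_ne (0 : ℤ)] with k hk
  rw [Real.norm_of_nonneg (Real.rpow_nonneg (abs_nonneg _) _)]
  exact h k hk

/-- For `k ≠ 0`: `log(|k| + 2)/(1 + k²) ≤ 4 |k|^{-3/2}`. [folklore] -/
theorem log_div_one_add_sq_le {k : ℤ} (hk : k ≠ 0) :
    Real.log (|(k : ℝ)| + 2) / (1 + (k : ℝ) ^ 2) ≤ 4 * |(k : ℝ)| ^ (-(3 / 2 : ℝ)) := by
  set r : ℝ := |(k : ℝ)| with hr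
  have hr1 : 1 ≤ r := by
    rw [hr, ← Int.cast_abs]; exact_mod_cast Int.one_le_abs hk
  have hr0 : 0 < r := by linarith
  have hk2 : (k : ℝ) ^ 2 = r ^ 2 := by rw [hr, sq_abs]
  -- log(r + 2) ≤ log (3 r) ≤ log 3 + 2 √r ≤ 4 r^{1/2}
  have hsqrt1 : 1 ≤ r ^ (1 / 2 : ℝ) := Real.one_le_rpow hr1 (by norm_num)
  have hlog3 : Real.log 3 ≤ 2 := by
    rw [Real.log_le_iff_le_exp (by norm_num)]
    have := Real.add_one_le_exp (2 : ℝ)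
    nlinarith [Real.exp_pos 1, Real.add_one_le_exp (1 : ℝ), Real.exp_add 1 1]
  have hlogr : Real.log r ≤ 2 * r ^ (1 / 2 : ℝ) := by
    have := Real.log_le_rpow_div hr0.le (by norm_num : (0 : ℝ) < 1 / 2)
    linarith
  have hlog : Real.log (r + 2) ≤ 4 * r ^ (1 / 2 : ℝ) := by
    calc Real.log (r + 2) ≤ Real.log (3 * r) := Real.log_le_log (by linarith) (by linarith)
      _ = Real.log 3 + Real.log r := Real.log_mul (by norm_num) hr0.ne'
      _ ≤ 2 + 2 * r ^ (1 / 2 : ℝ) := add_le_add hlog3 hlogr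
      _ ≤ 4 * r ^ (1 / 2 : ℝ) := by linarith
  have hden : r ^ 2 ≤ 1 + (k : ℝ) ^ 2 := by rw [hk2]; linarith
  calc Real.log (r + 2) / (1 + (k : ℝ) ^ 2) ≤ 4 * r ^ (1 / 2 : ℝ) / r ^ 2 := by
        gcongr
    _ = 4 * r ^ (-(3 / 2 : ℝ)) := by
        rw [mul_div_assoc, show (-(3 / 2 : ℝ)) = 1 / 2 - 2 by norm_num, Real.rpow_sub hr0,
          Real.rpow_two]

/-- `Σ_{k∈ℤ} log(|k|+2)/(1+k²) < ∞`. [folklore] -/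
theorem summable_log_div_one_add_sq :
    Summable fun k : ℤ ↦ Real.log (|(k : ℝ)| + 2) / (1 + (k : ℝ) ^ 2) := by
  refine summable_of_le_abs_rpow 4 fun k hk ↦ ?_
  rw [Real.norm_of_nonneg (div_nonneg (Real.log_nonneg (by linarith [abs_nonneg (k : ℝ)]))
    (by positivity))]
  exact log_div_one_add_sq_le hk

/-- `Σ_{k∈ℤ} 1/(1+k²) < ∞`. [folklore] -/
theorem summable_one_div_one_add_sq : Summable fun k : ℤ ↦ 1 / (1 + (k : ℝ) ^ 2) := by
  have hlog2 : (1 : ℝ) / 2 ≤ Real.log 2 := by linarith [Real.log_two_gt_d9]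
  refine (summable_log_div_one_add_sq.mul_left 2).of_nonneg_of_le (fun k ↦ by positivity)
    fun k ↦ ?_
  have h2 : Real.log 2 ≤ Real.log (|(k : ℝ)| + 2) :=
    Real.log_le_log two_pos (by linarith [abs_nonneg (k : ℝ)])
  rw [← mul_div_assoc, div_le_div_iff_of_pos_right (by positivity)]
  linarith

/-- `log(|t + k| + 2) ≤ log(|t| + 2) + log(|k| + 2)`. [folklore] -/
theorem log_abs_add_le (t k : ℝ) :
    Real.log (|t + k| + 2) ≤ Real.log (|t| + 2) + Real.log (|k| + 2) := by
  rw [← Real.log_mul (by positivity) (by positivity)]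
  refine Real.log_le_log (by positivity) ?_
  nlinarith [abs_add_le t k, abs_nonneg t, abs_nonneg k]

/-- The kernel sum over the windows is `≪ log(|t| + 2)`:
`Σ_k (4/(1+k²)) log(|t+k|+2) ≤ C log(|t|+2)` with an absolute `C`, and the series converges. [folklore] -/
theorem exists_tsum_kernel_windows_le :
    ∃ C : ℝ, 0 < C ∧ ∀ t : ℝ,
      (Summable fun k : ℤ ↦ 4 / (1 + (k : ℝ) ^ 2) * Real.log (|t + k| + 2)) ∧
      ∑' k : ℤ, 4 / (1 + (k : ℝ) ^ 2) * Real.log (|t + k| + 2) ≤ C * Real.log (|t| + 2) := by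
  set A : ℝ := ∑' k : ℤ, 1 / (1 + (k : ℝ) ^ 2) with hA
  set B : ℝ := ∑' k : ℤ, Real.log (|(k : ℝ)| + 2) / (1 + (k : ℝ) ^ 2) with hB
  have hA0 : 0 ≤ A := tsum_nonneg fun k ↦ by positivity
  have hB0 : 0 ≤ B := tsum_nonneg fun k ↦ div_nonneg
    (Real.log_nonneg (by linarith [abs_nonneg (k : ℝ)])) (by positivity)
  have hlog2 : (1 : ℝ) / 2 ≤ Real.log 2 := by linarith [Real.log_two_gt_d9]
  refine ⟨4 * A + 8 * B + 1, by positivity, fun t ↦ ?_⟩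
  have hlt : Real.log 2 ≤ Real.log (|t| + 2) := Real.log_le_log two_pos (by linarith [abs_nonneg t])
  have hlt0 : 0 ≤ Real.log (|t| + 2) := le_trans (by linarith) hlt
  -- majorant
  have h1 : Summable fun k : ℤ ↦ 4 * Real.log (|t| + 2) * (1 / (1 + (k : ℝ) ^ 2)) :=
    summable_one_div_one_add_sq.mul_left _
  have h2 : Summable fun k : ℤ ↦ 4 * (Real.log (|(k : ℝ)| + 2) / (1 + (k : ℝ) ^ 2)) :=
    summable_log_div_one_add_sq.mul_left _
  have hgs := h1.add h2
  have hle : ∀ k : ℤ, 4 / (1 + (k : ℝ) ^ 2) * Real.log (|t + k| + 2) ≤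
      4 * Real.log (|t| + 2) * (1 / (1 + (k : ℝ) ^ 2)) +
        4 * (Real.log (|(k : ℝ)| + 2) / (1 + (k : ℝ) ^ 2)) := by
    intro k
    have h := log_abs_add_le t k
    have hpos : (0 : ℝ) < 1 + (k : ℝ) ^ 2 := by positivity
    calc 4 / (1 + (k : ℝ) ^ 2) * Real.log (|t + k| + 2)
        ≤ 4 / (1 + (k : ℝ) ^ 2) * (Real.log (|t| + 2) + Real.log (|(k : ℝ)| + 2)) := by gcongr
      _ = _ := by ring
  have hnn : ∀ k : ℤ, 0 ≤ 4 / (1 + (k : ℝ) ^ 2) * Real.log (|t + k| + 2) := fun k ↦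
    mul_nonneg (by positivity) (Real.log_nonneg (by linarith [abs_nonneg (t + k)]))
  have hs : Summable fun k : ℤ ↦ 4 / (1 + (k : ℝ) ^ 2) * Real.log (|t + k| + 2) :=
    hgs.of_nonneg_of_le hnn hle
  refine ⟨hs, ?_⟩
  calc ∑' k : ℤ, 4 / (1 + (k : ℝ) ^ 2) * Real.log (|t + k| + 2)
      ≤ ∑' k : ℤ, (4 * Real.log (|t| + 2) * (1 / (1 + (k : ℝ) ^ 2)) +
          4 * (Real.log (|(k : ℝ)| + 2) / (1 + (k : ℝ) ^ 2))) := hs.tsum_le_tsum hle hgs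
    _ = 4 * Real.log (|t| + 2) * A + 4 * B := by
        rw [h1.tsum_add h2, tsum_mul_left, tsum_mul_left]
    _ ≤ (4 * A + 8 * B + 1) * Real.log (|t| + 2) := by
        nlinarith

/-! ## `Σ_ρ m(ρ)/(1 + (γ − t)²) ≪ log(|t| + 2)` and the far tail -/

/-- `1/(1 + x²) ≤ 4/(1 + round(x)²)`. [folklore] -/
theorem one_div_one_add_sq_le_round (x : ℝ) :
    1 / (1 + x ^ 2) ≤ 4 / (1 + ((round x : ℤ) : ℝ) ^ 2) := by
  have hk := abs_sub_round x
  have h1 : |((round x : ℤ) : ℝ)| ≤ |x| + 1 / 2 := by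
    have := abs_sub_abs_le_abs_sub ((round x : ℤ) : ℝ) x
    rw [abs_sub_comm] at hk
    linarith
  rw [div_le_div_iff₀ (by positivity) (by positivity), one_mul]
  have h2 : ((round x : ℤ) : ℝ) ^ 2 ≤ (|x| + 1 / 2) ^ 2 := by
    rw [← sq_abs]
    exact pow_le_pow_left₀ (abs_nonneg _) h1 2
  nlinarith [abs_nonneg x, sq_abs x]

open ZetaZeros.riemannZetaNontrivialZeros in
/-- **`Σ_ρ m(ρ)/(1 + (γ − t)²) ≪ log(|t| + 2)`** uniformly in real `t`, for every finite set of
non-trivial zeros (each counted with its multiplicity `m(ρ)`); this is the estimate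
"`Σ_{ρ} min(1, |ρ − ρ₀|⁻²) ≪ log T`" of the proof of Lemma 15 (p. 10), a consequence of
`N(T+1) − N(T) ≪ log T`. [cite: MaynardPratt2024, Lemma 15 (proof)] -/
theorem exists_sum_order_div_one_add_sq_le :
    ∃ C : ℝ, 0 < C ∧ ∀ (t : ℝ) (F : Finset ℂ),
      (∀ ρ ∈ F, ρ ∈ RHWave0.riemannZetaNontrivialZeros) →
      ∑ ρ ∈ F, (riemannZetaZeroOrder ρ : ℝ) / (1 + (ρ.im - t) ^ 2) ≤ C * Real.log (|t| + 2) := by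
  obtain ⟨C₀, hC₀, hwin⟩ := exists_sum_order_window_le
  obtain ⟨C₁, hC₁, hker⟩ := exists_tsum_kernel_windows_le
  refine ⟨C₀ * C₁, by positivity, fun t F hF ↦ ?_⟩
  obtain ⟨hs, hb⟩ := hker t
  have key := sum_order_mul_le_tsum_windows hC₀.le hwin t F hF
    (fun ρ ↦ 1 / (1 + (ρ.im - t) ^ 2)) (fun k ↦ 4 / (1 + (k : ℝ) ^ 2)) (fun k ↦ by positivity) hs
    (fun ρ _ ↦ one_div_one_add_sq_le_round (ρ.im - t))
  calc ∑ ρ ∈ F, (riemannZetaZeroOrder ρ : ℝ) / (1 + (ρ.im - t) ^ 2)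
      = ∑ ρ ∈ F, (riemannZetaZeroOrder ρ : ℝ) * (1 / (1 + (ρ.im - t) ^ 2)) := by
        simp_rw [mul_one_div]
    _ ≤ C₀ * ∑' k : ℤ, 4 / (1 + (k : ℝ) ^ 2) * Real.log (|t + k| + 2) := key
    _ ≤ C₀ * (C₁ * Real.log (|t| + 2)) := by gcongr
    _ = _ := by ring

/-- Monotonicity used for the far zeros: for `25 ≤ a ≤ u`,
`u² e^{−(4/5)√u} ≤ a² e^{−(4/5)√a}` (with `u = v²`, `a = b²`: `4 log(v/b) ≤ 4(v−b)/b ≤ (4/5)(v−b)`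
as `b ≥ 5`). [folklore] -/
theorem sq_mul_exp_neg_sqrt_le {a u : ℝ} (ha : 25 ≤ a) (hau : a ≤ u) :
    u ^ 2 * Real.exp (-(4 / 5 * √u)) ≤ a ^ 2 * Real.exp (-(4 / 5 * √a)) := by
  have ha0 : 0 ≤ a := by linarith
  have hu0 : 0 ≤ u := by linarith
  set b := √a with hb_def
  set v := √u with hv_def
  have hb : 5 ≤ b := by
    rw [hb_def, Real.le_sqrt' (by norm_num)]; linarith
  have hb0 : 0 < b := by linarith
  have hbv : b ≤ v := Real.sqrt_le_sqrt hau
  have ha' : a = b ^ 2 := (Real.sq_sqrt ha0).symm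
  have hu' : u = v ^ 2 := (Real.sq_sqrt hu0).symm
  have key : v ^ 4 ≤ b ^ 4 * Real.exp (4 / 5 * (v - b)) := by
    have h1 : v / b ≤ Real.exp (v / b - 1) := by linarith [Real.add_one_le_exp (v / b - 1)]
    have h3 : Real.exp (4 * (v / b - 1)) ≤ Real.exp (4 / 5 * (v - b)) := by
      rw [Real.exp_le_exp, show 4 * (v / b - 1) = (v - b) * (4 / b) by field_simp]
      have : 4 / b ≤ 4 / 5 := div_le_div_of_nonneg_left (by norm_num) (by norm_num) hb
      nlinarith
    calc v ^ 4 = (v / b) ^ 4 * b ^ 4 := by field_simp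
      _ ≤ Real.exp (v / b - 1) ^ 4 * b ^ 4 := by gcongr
      _ = Real.exp (4 * (v / b - 1)) * b ^ 4 := by rw [← Real.exp_nat_mul]; norm_num
      _ ≤ Real.exp (4 / 5 * (v - b)) * b ^ 4 := by gcongr
      _ = _ := mul_comm _ _
  rw [ha', hu']
  calc (v ^ 2) ^ 2 * Real.exp (-(4 / 5 * v)) = v ^ 4 * Real.exp (-(4 / 5 * v)) := by ring
    _ ≤ b ^ 4 * Real.exp (4 / 5 * (v - b)) * Real.exp (-(4 / 5 * v)) := by gcongr
    _ = (b ^ 2) ^ 2 * Real.exp (-(4 / 5 * b)) := by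
        rw [mul_assoc, ← Real.exp_add]; ring_nf

open ZetaZeros.riemannZetaNontrivialZeros in
/-- **The far zeros** (cf. "if `|ρ − ρ₀| > (log T)²/2` then `W₀(ρ−ρ₀) ≪ T^{−1/100}|ρ−ρ₀|⁻²` …
these terms are negligible", proof of Proposition 16, p. 10), in the form needed with the
sub-exponential Mellin decay `e^{−(4/5)√|t|}` of `W₀`: for `M ≥ 25`, every real `t` and every finite
set of non-trivial zeros at vertical distance `≥ M` from `t`,
`Σ m(ρ) e^{−(4/5)√|γ−t|} ≤ C M² e^{−(4/5)√M} log(|t|+2)` with an absolute `C`.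
[cite: MaynardPratt2024, Proposition 16 (proof)] -/
theorem exists_sum_order_mul_exp_neg_sqrt_le :
    ∃ C : ℝ, 0 < C ∧ ∀ (t M : ℝ), 25 ≤ M → ∀ F : Finset ℂ,
      (∀ ρ ∈ F, ρ ∈ RHWave0.riemannZetaNontrivialZeros ∧ M ≤ |ρ.im - t|) →
      ∑ ρ ∈ F, (riemannZetaZeroOrder ρ : ℝ) * Real.exp (-(4 / 5 * √|ρ.im - t|)) ≤
        C * M ^ 2 * Real.exp (-(4 / 5 * √M)) * Real.log (|t| + 2) := by
  obtain ⟨C₁, hC₁, h1⟩ := exists_sum_order_div_one_add_sq_le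
  refine ⟨2 * C₁, by positivity, fun t M hM F hF ↦ ?_⟩
  have hF' : ∀ ρ ∈ F, ρ ∈ RHWave0.riemannZetaNontrivialZeros := fun ρ hρ ↦ (hF ρ hρ).1
  have key := h1 t F hF'
  have hm0 : ∀ ρ ∈ F, (0 : ℝ) ≤ riemannZetaZeroOrder ρ := fun ρ hρ ↦
    riemannZetaZeroOrder_nonneg_of_zero (zeta_eq_zero (hF' ρ hρ))
  calc ∑ ρ ∈ F, (riemannZetaZeroOrder ρ : ℝ) * Real.exp (-(4 / 5 * √|ρ.im - t|))
      ≤ ∑ ρ ∈ F, (riemannZetaZeroOrder ρ : ℝ) *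
          (2 * M ^ 2 * Real.exp (-(4 / 5 * √M)) / (1 + (ρ.im - t) ^ 2)) := by
        refine Finset.sum_le_sum fun ρ hρ ↦ mul_le_mul_of_nonneg_left ?_ (hm0 ρ hρ)
        set x := |ρ.im - t| with hx_def
        have hx : M ≤ x := (hF ρ hρ).2
        have hmono := sq_mul_exp_neg_sqrt_le hM hx
        have hx2 : (ρ.im - t) ^ 2 = x ^ 2 := (sq_abs _).symm
        rw [hx2, le_div_iff₀ (by positivity)]
        have hx1 : 1 + x ^ 2 ≤ 2 * x ^ 2 := by nlinarith
        calc Real.exp (-(4 / 5 * √x)) * (1 + x ^ 2) ≤ Real.exp (-(4 / 5 * √x)) * (2 * x ^ 2) := by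
              gcongr
          _ = 2 * (x ^ 2 * Real.exp (-(4 / 5 * √x))) := by ring
          _ ≤ 2 * (M ^ 2 * Real.exp (-(4 / 5 * √M))) := by gcongr
          _ = _ := by ring
    _ = 2 * M ^ 2 * Real.exp (-(4 / 5 * √M)) *
          ∑ ρ ∈ F, (riemannZetaZeroOrder ρ : ℝ) / (1 + (ρ.im - t) ^ 2) := by
        rw [Finset.mul_sum]
        refine Finset.sum_congr rfl fun ρ _ ↦ by ring
    _ ≤ 2 * M ^ 2 * Real.exp (-(4 / 5 * √M)) * (C₁ * Real.log (|t| + 2)) := by gcongr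
    _ = _ := by ring

end MaynardPratt

end Literature.NumberTheory.LFunctions
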